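import Literature.Analysis.FluidPDE.TsaiLocalEnergyRRS
import Literature.Analysis.FluidPDE.CKNLocalRegularityRRSPressure
import HarnessLib

/-!
# Tsai 1998, remark after Lemma 4.2: the top singular set is `μH[1]`-null — discharged

Analysis/FluidPDE proofs file (one theorem: no definitions, no named facts) closing the named fact
`Literature.Analysis.FluidPDE.tsai1998_top_singular_null` (`TsaiLocalEnergy.lean`; T.-P. Tsai,
*On Leray's self-similar solutions of the Navier–Stokes equations satisfying local energy
estimates*, Arch. Rational Mech. Anal. 143 (1998) 29–51, the remark after **Lemma 4.2**, p. 46: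
"this lemma implies that the singular set at the top of the parabolic cylinder also has
one-dimensional Hausdorff measure zero").

Every step of the chain is already proved in tree; this file only composes the two ends, which
live in files that do not import each other:

* `tsai1998_top_singular_null_of_theorem15_3 : RRS2016.theorem15_3 → tsai1998_top_singular_null`
  (`TsaiLocalEnergyRRS.lean`): Lemma 4.2 at the top of the cylinder from the three
  Caffarelli–Kohn–Nirenberg decay estimates (`localEnergyEstimate_holds`, `pressureEstimate_holds`,
  `interpolationEstimate_holds`) and Robinson–Rodrigo–Sadowski's first local regularity theorem,
  applied on cylinders shifted into the past and exhausting the top cylinder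
  (`tsai1998_lemma42_unit_of_oneScale`, after `tsai1998_lemma42_unit_of_estimates` of
  `TsaiLocalEnergyProofs.lean`), then the Vitali covering argument
  `tsai1998_top_singular_null_of_lemma42` (`TsaiLocalEnergy.lean`);
* `RRS2016.theorem15_3_holds : RRS2016.theorem15_3` (`CKNLocalRegularityRRSPressure.lean`):
  Robinson–Rodrigo–Sadowski 2016, Thm. 15.3, proved through Lemma 15.11, Lemma 15.12 and
  Steps 1–4 of pp. 220–226.

Hence `tsai1998_top_singular_null_holds`, with no remaining named-fact hypotheses.

## Mathlib / tree search

`lean search 'tsai1998_top_singular_null'`: the def (`TsaiLocalEnergy.lean:584`), the covering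
reduction `tsai1998_top_singular_null_of_lemma42` (ibid.), `tsai1998_top_singular_null_of_estimates`
(`TsaiLocalEnergyProofs.lean`, via Lemarié-Rieusset's Thm. 14.4) and
`tsai1998_top_singular_null_of_theorem15_3` (`TsaiLocalEnergyRRS.lean`); no `_holds` before this
file. The alternative composition through Thm. 14.4,
`tsai1998_top_singular_null_of_estimates localEnergyEstimate_holds pressureEstimate_holds
interpolationEstimate_holds (lemarieRieusset_epsilon_regularity_of_lemma15_12 RRS2016.lemma15_12_holds)`
(`CKNEpsilonRegularityForce.lean`), proves the same statement with a heavier import closure.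

## References

* T.-P. Tsai, *On Leray's self-similar solutions of the Navier–Stokes equations satisfying local
  energy estimates*, Arch. Rational Mech. Anal. 143 (1998), 29–51, doi:10.1007/s002050050099:
  Lemma 4.2 and the remark following it (p. 46). [Tsai1998]
* J. C. Robinson, J. L. Rodrigo, W. Sadowski, *The three-dimensional Navier–Stokes equations*,
  Cambridge Studies in Advanced Mathematics 157 (2016): Thm. 15.3 (pp. 220–226), Lemma 15.12
  (p. 232). [RobinsonRodrigoSadowski2016]
* L. Caffarelli, R. Kohn, L. Nirenberg, *Partial regularity of suitable weak solutions of the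
  Navier–Stokes equations*, Comm. Pure Appl. Math. 35 (1982), 771–831: Propositions 1–2, §6.
  [CaffarelliKohnNirenberg1982]
-/

noncomputable section

namespace Literature.Analysis.FluidPDE

/-- **Tsai 1998, remark after Lemma 4.2 (p. 46), discharged**: for a suitable weak solution of the
Navier–Stokes equations in a parabolic cylinder `Q_ρ(T, x₀)` (velocity in the local energy
classes, pressure in `L^{3/2}`), the set of singular points on the top slice `{t = T}` is
`μH[1]`-null — the named fact `tsai1998_top_singular_null`, with no hypotheses left. Proof:
the accepted reduction to Robinson–Rodrigo–Sadowski's Thm. 15.3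
(`tsai1998_top_singular_null_of_theorem15_3`: Lemma 4.2 at the top of the cylinder from the
discharged Caffarelli–Kohn–Nirenberg decay estimates and the one-scale criterion on cylinders
shifted into the past, then the Vitali covering argument `tsai1998_top_singular_null_of_lemma42`)
fed with the discharge `RRS2016.theorem15_3_holds`.
[cite: Tsai1998, remark after Lemma 4.2 (p. 46); RobinsonRodrigoSadowski2016, Thm. 15.3 p. 220] -/
theorem tsai1998_top_singular_null_holds : tsai1998_top_singular_null :=
  tsai1998_top_singular_null_of_theorem15_3 RRS2016.theorem15_3_holds

end Literature.Analysis.FluidPDE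

end
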